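import Literature.Topology.FourManifolds.CollarUniquenessBall
import HarnessLib

/-!
# Smoothing a crease along a hyperplane (codimension-one step of the smoothing of PD homeomorphisms)

Topic `Literature/Topology/FourManifolds`; Euclidean analysis in `E × ℝ` (`E` a finite-dimensional
real normed space, the *face* `E × {0}`, normal coordinate `s`).  This is the codimension-one
("face") step of the smoothing theory of piecewise-differentiable homeomorphisms — Munkres,
*Obstructions to the smoothing of piecewise-differentiable homeomorphisms*, Ann. of Math. 72 (1960)
§§2–3; in the explicit convex-combination form of Campbell–D'Onofrio–Vítek, *Diffeomorphic
approximation of piecewise affine homeomorphisms*, J. Geom. Anal. (2026), **Lemma 3.1** (there for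
two AFFINE pieces `A₁, A₂` of a homeomorphism of `ℝ³`, `g_w = (1 - η(x₁/w)) A₁ + η(x₁/w) A₂`),
generalised to a smooth piece whose first-order data vary along the face.

**Setting (one-sided normal form).** A *crease* is a map of `E × ℝ` equal to a smooth map `G` on
the lower half space `{s ≤ 0}` and to the identity on the upper half space `{s ≥ 0}`, where `G`
fixes the face pointwise (`G (x, 0) = (x, 0)` for `x` in an open set `V ⊇ K`, `K` compact) and
crosses it in the same sense as the identity (`(DG (x,0) (0,1)).2 > 0`).  (Two smooth pieces
`U₋ | {s ≤ 0}`, `U₊ | {s ≥ 0}` of a homeomorphism are brought to this form by the target chart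
`U₊⁻¹`; this reduction is the consumer's.)  Then `DG (x, 0) = [[I, c x], [0, a x]]` with
`c x = (DG (x,0) (0,1)).1`, `a x = (DG (x,0) (0,1)).2 > 0` (`creaseNormal`).

**Construction** (`creaseMap G L w`).  With `η = Real.smoothTransition` and the *slow ramp*
`λ = creaseRamp L w` (`= 0` on `(-∞, 2w]`, `= 1` on `[2w·e^L, ∞)`, `|s λ'(s)| ≤ C₀ / L`, built
from the log-slow cutoff `logCutoff` of `CollarUniquenessBall.lean`), put
`F (x, s) = (x + s (1 - λ s) • c x, s ((1 - λ s) a x + λ s))` (`creaseShear`: for `s ≤ 2w` this is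
the *first-order matching* shear `F₀ (x, s) = (x + s • c x, s · a x)`, whose derivative on the face
equals `DG (x, 0)`; for `s ≥ 2w e^L` it is the identity) and
`g = G + η(s/w) • (F - G)` (`creaseMap`).  Then `g = G` on `{s ≤ 0}`, `g = id` on `{s ≥ 2w e^L}`,
`g` is `C^∞`, and on `V' × [0, 2w e^L]` (`V'` a neighbourhood of `K`), for `L` large and `w`
small (`exists_creaseMap_estimates`):

* `‖g p - p‖ ≤ ε` and `‖Dg p (v, 0) - (v, 0)‖ ≤ ε ‖v‖` (the face directions are almost fixed);
* `a₀ ≤ (Dg p (0, 1)).2 ≤ A₀` and `‖(Dg p (0, 1)).1‖ ≤ C₀` with constants `a₀ > 0`, `A₀`, `C₀`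
  depending only on `G` near `K` (NOT on `ε`): the normal column stays in a fixed compact set of
  transverse vectors.

In particular `Dg p` is within `ε` of an upper-triangular operator `[[I, *], [0, a]]`, `a ≥ a₀`, so
`g` is a local diffeomorphism across the former crease with a priori bounds — the form consumed
by the higher-codimension steps (Campbell–D'Onofrio–Vítek, Lemma 3.2/3.4: "`Λ` bounded away from
zero as soon as `w/R` is small").  On the blend zone `[0, 2w)` the key point is that
`Δ = F₀ - G` vanishes to second order on the face, so the cross term `η'(s/w)/w • Δ = O(w)` in
`C⁰` AND its contribution `O(w)` to `Dg`; on the ramp zone `(w, 2w e^L]` one has `g = F` and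
`DF (0,1) = (((1-λ) - sλ') • c, (1-λ) a + λ + sλ'(1-a))`, positive in the normal component because
`|sλ'| ≤ C₀/L` is small (this is why the ramp must be slow on a logarithmic scale: `a x` may be far
from `1`).  Injectivity of `g` is not asserted (and not needed downstream, where bijectivity comes
from sheet counting, `Literature/Topology/ProperLocalHomeomorph.lean`).

Main statements: `creaseRamp`, `creaseNormal`, `creaseShear`, `creaseMap` (definitions);
`contDiff_creaseMap`, `creaseMap_of_nonpos`, `creaseMap_of_le` (identities);
`exists_creaseMap_estimates` (the estimates); `exists_crease_smoothing` (packaged existence form).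
No named facts are introduced.

## References

* J. R. Munkres, *Obstructions to the smoothing of piecewise-differentiable homeomorphisms*, Ann.
  of Math. (2) 72 (1960), 521–554, §§2–3. [Munkres1960]
* D. Campbell, L. D'Onofrio, T. Vítek, *Diffeomorphic approximation of piecewise affine
  homeomorphisms*, J. Geom. Anal. (2026), doi:10.1007/s12220-026-02398-w, arXiv:2507.02854,
  Lemma 3.1. [CampbellDonofrioVitek2026]
* M. W. Hirsch, *Differential Topology* (1976), Ch. 8 §2 (straightening angles / smoothing along a
  hypersurface). [HirschDT1976]
-/

noncomputable section

open Set Function Metric Filter Real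
open scoped Topology ContDiff

namespace Literature.Topology.FourManifolds

/-! ### §A The slow ramp -/

section Ramp

/-- **The slow ramp** `λ = creaseRamp L w`: equal to `0` on `(-∞, 2w]`, to `1` on `[2w·e^L, ∞)`,
with values in `[0, 1]` and `|s · λ'(s)| ≤ C₀ / L` — it climbs on a logarithmic scale, through the
log-slow cutoff `logCutoff L` of `CollarUniquenessBall.lean` evaluated at `s e^{-2L} / (2w)`.
(The `if` only fixes junk values for `s ≤ w`, where the formula would involve `log` of a
nonpositive number; both branches vanish on `(w, 2w]`.) [folklore] -/
def creaseRamp (L w s : ℝ) : ℝ :=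
  if s ≤ w then 0 else 1 - logCutoff L (s * (exp (-2 * L) / (2 * w)))

variable {L w s : ℝ}

/-- The ramp vanishes on `(-∞, 2w]`. [folklore] -/
theorem creaseRamp_eq_zero (hL : 0 < L) (hw : 0 < w) (hs : s ≤ 2 * w) : creaseRamp L w s = 0 := by
  unfold creaseRamp
  split_ifs with h
  · rfl
  · have hs0 : 0 < s := hw.trans (lt_of_not_ge h)
    rw [logCutoff_eq_one hL (by positivity) ?_, sub_self]
    rw [← mul_div_assoc, div_le_iff₀ (by positivity)]
    calc s * exp (-2 * L) ≤ (2 * w) * exp (-2 * L) := by gcongr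
      _ = exp (-2 * L) * (2 * w) := by ring

/-- The ramp equals `1` on `[2w e^L, ∞)`. [folklore] -/
theorem creaseRamp_eq_one (hL : 0 < L) (hw : 0 < w) (hs : 2 * w * exp L ≤ s) :
    creaseRamp L w s = 1 := by
  unfold creaseRamp
  have hws : w < s := by
    have h1 : (1 : ℝ) ≤ exp L := one_le_exp hL.le
    nlinarith
  rw [if_neg (not_le.2 hws), logCutoff_eq_zero hL ?_, sub_zero]
  rw [← mul_div_assoc, le_div_iff₀ (by positivity)]
  have hexp : exp (-L) * (2 * w) = (2 * w * exp L) * exp (-2 * L) := by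
    have h := exp_add L (-2 * L)
    have h' : L + -2 * L = -L := by ring
    rw [h'] at h
    rw [mul_assoc (2 * w), ← h]
    ring
  rw [hexp]
  gcongr

/-- The ramp takes values in `[0, 1]`. [folklore] -/
theorem creaseRamp_mem_Icc (L w s : ℝ) : creaseRamp L w s ∈ Icc (0 : ℝ) 1 := by
  unfold creaseRamp
  split_ifs
  · exact ⟨le_rfl, zero_le_one⟩
  · exact ⟨sub_nonneg.2 (logCutoff_le_one _ _), sub_le_self _ (logCutoff_nonneg _ _)⟩

/-- The ramp is nonnegative. [folklore] -/
theorem creaseRamp_nonneg (L w s : ℝ) : 0 ≤ creaseRamp L w s := (creaseRamp_mem_Icc L w s).1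

/-- The ramp is at most `1`. [folklore] -/
theorem creaseRamp_le_one (L w s : ℝ) : creaseRamp L w s ≤ 1 := (creaseRamp_mem_Icc L w s).2

/-- Above `w` the ramp is given by the log-slow formula. [folklore] -/
theorem creaseRamp_eventuallyEq (hws : w < s) :
    creaseRamp L w =ᶠ[𝓝 s] fun s' => 1 - logCutoff L (s' * (exp (-2 * L) / (2 * w))) := by
  filter_upwards [Ioi_mem_nhds hws] with s' hs'
  rw [creaseRamp, if_neg (not_le.2 hs')]

/-- Below `2w` the ramp is locally zero. [folklore] -/
theorem creaseRamp_eventuallyEq_zero (hL : 0 < L) (hw : 0 < w) (hs : s < 2 * w) :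
    creaseRamp L w =ᶠ[𝓝 s] fun _ => 0 := by
  filter_upwards [Iio_mem_nhds hs] with s' hs'
  exact creaseRamp_eq_zero hL hw hs'.le

/-- The ramp is `C^∞`. [folklore] -/
theorem contDiff_creaseRamp (hL : 0 < L) (hw : 0 < w) : ContDiff ℝ ∞ (creaseRamp L w) := by
  refine contDiff_iff_contDiffAt.2 fun s => ?_
  by_cases hs : s < 2 * w
  · exact contDiffAt_const.congr_of_eventuallyEq (creaseRamp_eventuallyEq_zero hL hw hs)
  · have hws : w < s := by linarith
    refine ContDiffAt.congr_of_eventuallyEq ?_ (creaseRamp_eventuallyEq hws)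
    have hne : s * (exp (-2 * L) / (2 * w)) ≠ 0 := by
      have : 0 < s := hw.trans hws
      positivity
    have h1 : ContDiffAt ℝ ∞ (fun s' => logCutoff L (s' * (exp (-2 * L) / (2 * w)))) s :=
      ContDiffAt.comp (g := logCutoff L) (f := fun s' => s' * (exp (-2 * L) / (2 * w))) s
        (contDiffAt_logCutoff hne) (contDiffAt_id.mul contDiffAt_const)
    exact contDiffAt_const.sub h1

/-- The derivative of the ramp above `w`. [folklore] -/
theorem hasDerivAt_creaseRamp (hw : 0 < w) (hws : w < s) :
    HasDerivAt (creaseRamp L w)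
      (-(deriv (logCutoff L) (s * (exp (-2 * L) / (2 * w))) * (exp (-2 * L) / (2 * w)))) s := by
  set k : ℝ := exp (-2 * L) / (2 * w) with hk
  have hne : s * k ≠ 0 := by
    have : 0 < s := hw.trans hws
    positivity
  have h1 : HasDerivAt (logCutoff L) (deriv (logCutoff L) (s * k)) (s * k) :=
    ((hasDerivAt_logCutoff hne).differentiableAt).hasDerivAt
  have h2 : HasDerivAt (fun s' => logCutoff L (s' * k)) (deriv (logCutoff L) (s * k) * k) s :=
    HasDerivAt.comp (h₂ := logCutoff L) (h := fun s' => s' * k) s h1 (hasDerivAt_mul_const k)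
  exact (h2.const_sub 1).congr_of_eventuallyEq (creaseRamp_eventuallyEq hws)

/-- **Slowness of the ramp**: `|s · λ'(s)| ≤ C₀ / L`, with `C₀ = smoothTransitionDerivBound`.
[folklore] -/
theorem abs_mul_deriv_creaseRamp_le (hL : 0 < L) (hw : 0 < w) (s : ℝ) :
    |s * deriv (creaseRamp L w) s| ≤ smoothTransitionDerivBound / L := by
  by_cases hs : s < 2 * w
  · rw [(creaseRamp_eventuallyEq_zero hL hw hs).deriv_eq, deriv_const, mul_zero, abs_zero]
    exact div_nonneg smoothTransitionDerivBound_pos.le hL.le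
  · have hws : w < s := by linarith
    rw [(hasDerivAt_creaseRamp (L := L) hw hws).deriv]
    set k : ℝ := exp (-2 * L) / (2 * w) with hk
    have hne : s * k ≠ 0 := by
      have : 0 < s := hw.trans hws
      positivity
    have : s * -(deriv (logCutoff L) (s * k) * k) = -((s * k) * deriv (logCutoff L) (s * k)) := by
      ring
    rw [this, abs_neg]
    exact abs_mul_deriv_logCutoff_le hL hne

/-- The slowness bound in the form used below: `|s λ'(s)| ≤ θ` once `C₀ / θ ≤ L`. [folklore] -/
theorem abs_mul_deriv_creaseRamp_le_of_le (hL : 0 < L) (hw : 0 < w) {θ : ℝ} (hθ : 0 < θ)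
    (hLθ : smoothTransitionDerivBound / θ ≤ L) (s : ℝ) :
    |s * deriv (creaseRamp L w) s| ≤ θ := by
  refine (abs_mul_deriv_creaseRamp_le hL hw s).trans ?_
  rw [div_le_iff₀ hL]
  rw [div_le_iff₀ hθ] at hLθ
  linarith [mul_comm θ L]

end Ramp

/-! ### §B The first-order data of the crease and the maps `F`, `g` -/

section Maps

variable {E : Type*} [NormedAddCommGroup E] [NormedSpace ℝ E]

/-- **The normal column of the crease on the face**: `creaseNormal G x = DG (x, 0) (0, 1)`, whose
components are the shear vector `c x = (creaseNormal G x).1 : E` and the normal stretch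
`a x = (creaseNormal G x).2 : ℝ`. [folklore] -/
def creaseNormal (G : E × ℝ → E × ℝ) (x : E) : E × ℝ :=
  fderiv ℝ G (x, 0) (0, 1)

/-- **The shear** `F = creaseShear G L w`:
`F (x, s) = (x + s (1 - λ s) • c x, s ((1 - λ s) · a x + λ s))`, `λ = creaseRamp L w`. For
`s ≤ 2w` it is the first-order matching shear `(x + s • c x, s · a x)`, for `s ≥ 2w e^L` the
identity. Campbell–D'Onofrio–Vítek (2026), Lemma 3.1 (variable first-order data).
[cite: CampbellDonofrioVitek2026, Lemma 3.1] -/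
def creaseShear (G : E × ℝ → E × ℝ) (L w : ℝ) (p : E × ℝ) : E × ℝ :=
  (p.1 + (p.2 * (1 - creaseRamp L w p.2)) • (creaseNormal G p.1).1,
    p.2 * ((1 - creaseRamp L w p.2) * (creaseNormal G p.1).2 + creaseRamp L w p.2))

/-- The first-order matching shear `F₀ (x, s) = (x + s • c x, s · a x)` (the shear `creaseShear`
with the ramp switched off; they agree on `{s ≤ 2w}`). [folklore] -/
def creaseShear₀ (G : E × ℝ → E × ℝ) (p : E × ℝ) : E × ℝ :=
  (p.1 + p.2 • (creaseNormal G p.1).1, p.2 * (creaseNormal G p.1).2)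

/-- **The smoothed crease** `g = creaseMap G L w = G + η(s/w) • (F - G)` with
`η = Real.smoothTransition` and `F = creaseShear G L w`: equal to `G` on `{s ≤ 0}`, to `F` on
`{s ≥ w}`, hence to the identity on `{s ≥ 2w e^L}`.
Campbell–D'Onofrio–Vítek (2026), Lemma 3.1, `g_w = (1 - η(x₁/w)) A₁ + η(x₁/w) A₂`.
[cite: CampbellDonofrioVitek2026, Lemma 3.1] -/
def creaseMap (G : E × ℝ → E × ℝ) (L w : ℝ) (p : E × ℝ) : E × ℝ :=
  G p + smoothTransition (p.2 / w) • (creaseShear G L w p - G p)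

variable {G : E × ℝ → E × ℝ} {L w : ℝ} {p : E × ℝ}

/-- On `{s ≤ 2w}` the shear is the first-order matching shear. [folklore] -/
theorem creaseShear_eq_creaseShear₀ (hL : 0 < L) (hw : 0 < w) (hp : p.2 ≤ 2 * w) :
    creaseShear G L w p = creaseShear₀ G p := by
  simp only [creaseShear, creaseShear₀, creaseRamp_eq_zero hL hw hp, sub_zero, mul_one, one_mul,
    add_zero]

/-- On `{s ≥ 2w e^L}` the shear is the identity. [folklore] -/
theorem creaseShear_eq_self (hL : 0 < L) (hw : 0 < w) (hp : 2 * w * exp L ≤ p.2) :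
    creaseShear G L w p = p := by
  obtain ⟨x, s⟩ := p
  simp only [creaseShear, creaseRamp_eq_one hL hw hp, sub_self, mul_zero, zero_smul, add_zero,
    zero_mul, zero_add, mul_one]

/-- On the face the shear is the identity: `F (x, 0) = (x, 0)`. [folklore] -/
@[simp]
theorem creaseShear_face (x : E) : creaseShear G L w (x, 0) = (x, 0) := by
  simp [creaseShear]

/-- On the face the first-order matching shear is the identity. [folklore] -/
@[simp]
theorem creaseShear₀_face (x : E) : creaseShear₀ G (x, 0) = (x, 0) := by
  simp [creaseShear₀]

/-- **`g = G` on the lower half space.** [folklore] -/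
theorem creaseMap_of_nonpos (hw : 0 < w) (hp : p.2 ≤ 0) : creaseMap G L w p = G p := by
  rw [creaseMap, smoothTransition.zero_of_nonpos (div_nonpos_of_nonpos_of_nonneg hp hw.le),
    zero_smul, add_zero]

/-- `g = F` on `{s ≥ w}`. [folklore] -/
theorem creaseMap_of_le (hw : 0 < w) (hp : w ≤ p.2) : creaseMap G L w p = creaseShear G L w p := by
  rw [creaseMap, smoothTransition.one_of_one_le ((one_le_div hw).2 hp), one_smul, add_sub_cancel]

/-- **`g = id` above the layer**: `g p = p` for `p.2 ≥ 2w e^L`. [folklore] -/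
theorem creaseMap_eq_self (hL : 0 < L) (hw : 0 < w) (hp : 2 * w * exp L ≤ p.2) :
    creaseMap G L w p = p := by
  have hwp : w ≤ p.2 := by
    have h1 : (1 : ℝ) ≤ exp L := one_le_exp hL.le
    nlinarith
  rw [creaseMap_of_le hw hwp, creaseShear_eq_self hL hw hp]

/-- On `{s ≤ 2w}` the smoothed crease is the blend `g₀ = G + η(s/w) • (F₀ - G)` of `G` with the
first-order matching shear. [folklore] -/
theorem creaseMap_eq_blend₀ (hL : 0 < L) (hw : 0 < w) (hp : p.2 ≤ 2 * w) :
    creaseMap G L w p = G p + smoothTransition (p.2 / w) • (creaseShear₀ G p - G p) := by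
  rw [creaseMap, creaseShear_eq_creaseShear₀ hL hw hp]

/-! #### Smoothness -/

/-- The normal column `x ↦ DG (x, 0) (0, 1)` is `C^∞` when `G` is. [folklore] -/
theorem contDiff_creaseNormal (hG : ContDiff ℝ ∞ G) : ContDiff ℝ ∞ (creaseNormal G) := by
  have h1 : ContDiff ℝ ∞ (fderiv ℝ G) := (contDiff_infty_iff_fderiv.1 hG).2
  have h2 : ContDiff ℝ ∞ fun x : E => fderiv ℝ G (x, 0) :=
    h1.comp (contDiff_id.prodMk contDiff_const)
  exact h2.clm_apply contDiff_const

/-- The first-order matching shear is `C^∞`. [folklore] -/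
theorem contDiff_creaseShear₀ (hG : ContDiff ℝ ∞ G) : ContDiff ℝ ∞ (creaseShear₀ G) := by
  have hc : ContDiff ℝ ∞ fun p : E × ℝ => (creaseNormal G p.1).1 :=
    ((contDiff_creaseNormal hG).comp contDiff_fst).fst
  have ha : ContDiff ℝ ∞ fun p : E × ℝ => (creaseNormal G p.1).2 :=
    ((contDiff_creaseNormal hG).comp contDiff_fst).snd
  exact (contDiff_fst.add (contDiff_snd.smul hc)).prodMk (contDiff_snd.mul ha)

/-- The shear is `C^∞`. [folklore] -/
theorem contDiff_creaseShear (hG : ContDiff ℝ ∞ G) (hL : 0 < L) (hw : 0 < w) :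
    ContDiff ℝ ∞ (creaseShear G L w) := by
  have hc : ContDiff ℝ ∞ fun p : E × ℝ => (creaseNormal G p.1).1 :=
    ((contDiff_creaseNormal hG).comp contDiff_fst).fst
  have ha : ContDiff ℝ ∞ fun p : E × ℝ => (creaseNormal G p.1).2 :=
    ((contDiff_creaseNormal hG).comp contDiff_fst).snd
  have hl : ContDiff ℝ ∞ fun p : E × ℝ => creaseRamp L w p.2 :=
    (contDiff_creaseRamp hL hw).comp contDiff_snd
  refine (contDiff_fst.add ((contDiff_snd.mul (contDiff_const.sub hl)).smul hc)).prodMk ?_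
  exact contDiff_snd.mul (((contDiff_const.sub hl).mul ha).add hl)

/-- **The smoothed crease is `C^∞`.** [folklore] -/
theorem contDiff_creaseMap (hG : ContDiff ℝ ∞ G) (hL : 0 < L) (hw : 0 < w) :
    ContDiff ℝ ∞ (creaseMap G L w) := by
  have hη : ContDiff ℝ ∞ fun p : E × ℝ => smoothTransition (p.2 / w) :=
    smoothTransition.contDiff.comp (contDiff_snd.div_const w)
  exact hG.add (hη.smul ((contDiff_creaseShear hG hL hw).sub hG))

/-- The blend `g₀` is `C^∞`. [folklore] -/
theorem contDiff_blend₀ (hG : ContDiff ℝ ∞ G) (w : ℝ) :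
    ContDiff ℝ ∞ fun p : E × ℝ => G p + smoothTransition (p.2 / w) • (creaseShear₀ G p - G p) := by
  have hη : ContDiff ℝ ∞ fun p : E × ℝ => smoothTransition (p.2 / w) :=
    smoothTransition.contDiff.comp (contDiff_snd.div_const w)
  exact hG.add (hη.smul ((contDiff_creaseShear₀ hG).sub hG))

end Maps

/-! ### §C First-order structure on the face -/

section Face

variable {E : Type*} [NormedAddCommGroup E] [NormedSpace ℝ E]
variable {G : E × ℝ → E × ℝ} {V : Set E} {x : E}

/-- `∞ ≠ 0` in the smoothness exponents (bookkeeping; a private copy of the tree's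
`crease_infty_ne_zero` of `SPC4HandlesProofs.lean`, not imported here). [folklore] -/
private theorem crease_infty_ne_zero : (∞ : WithTop ℕ∞) ≠ 0 := by
  simp

/-- A `C^∞` map is differentiable (bookkeeping). [folklore] -/
theorem differentiableAt_of_contDiff {F' : Type*} [NormedAddCommGroup F'] [NormedSpace ℝ F']
    {F'' : Type*} [NormedAddCommGroup F''] [NormedSpace ℝ F''] {φ : F' → F''}
    (h : ContDiff ℝ ∞ φ) (q : F') : DifferentiableAt ℝ φ q :=
  h.contDiffAt.differentiableAt crease_infty_ne_zero

/-- **Face directions are fixed to first order**: if `G (y, 0) = (y, 0)` for `y` in an open set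
`V ∋ x`, then `DG (x, 0) (v, 0) = (v, 0)`. [folklore] -/
theorem fderiv_apply_inl_of_face (hG : ContDiff ℝ ∞ G) (hV : IsOpen V)
    (hface : ∀ y ∈ V, G (y, 0) = (y, 0)) (hx : x ∈ V) (v : E) :
    fderiv ℝ G (x, 0) (v, 0) = (v, 0) := by
  have hd : DifferentiableAt ℝ G (x, 0) := differentiableAt_of_contDiff hG _
  have h1 : HasFDerivAt (G ∘ fun y : E => (y, (0 : ℝ)))
      ((fderiv ℝ G (x, 0)).comp (ContinuousLinearMap.inl ℝ E ℝ)) x :=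
    hd.hasFDerivAt.comp x (hasFDerivAt_prodMk_left (𝕜 := ℝ) x (0 : ℝ))
  have h2 : HasFDerivAt (fun y : E => G (y, 0)) (ContinuousLinearMap.inl ℝ E ℝ) x := by
    refine (hasFDerivAt_prodMk_left (𝕜 := ℝ) x (0 : ℝ)).congr_of_eventuallyEq ?_
    filter_upwards [hV.mem_nhds hx] with y hy
    exact hface y hy
  have h := congrArg (fun L : E →L[ℝ] E × ℝ => L v) (h1.unique h2)
  simpa using h

/-- The derivative of `G` on the face, applied to `(v, r)`: `DG (x,0) (v, r) = (v, 0) + r • (c x, a x)`.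
[folklore] -/
theorem fderiv_face_apply (hG : ContDiff ℝ ∞ G) (hV : IsOpen V)
    (hface : ∀ y ∈ V, G (y, 0) = (y, 0)) (hx : x ∈ V) (v : E) (r : ℝ) :
    fderiv ℝ G (x, 0) (v, r) = (v, 0) + r • creaseNormal G x := by
  have hsplit : ((v, r) : E × ℝ) = (v, 0) + r • ((0 : E), (1 : ℝ)) := by
    ext <;> simp
  rw [hsplit, map_add, map_smul, fderiv_apply_inl_of_face hG hV hface hx v, creaseNormal]

/-- **The first-order matching shear fixes face directions**: `DF₀ (x, 0) (v, 0) = (v, 0)` (for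
every `x`, as `F₀ (y, 0) = (y, 0)` identically). [folklore] -/
theorem fderiv_creaseShear₀_apply_inl (hG : ContDiff ℝ ∞ G) (x v : E) :
    fderiv ℝ (creaseShear₀ G) (x, 0) (v, 0) = (v, 0) := by
  have hd : DifferentiableAt ℝ (creaseShear₀ G) (x, 0) :=
    differentiableAt_of_contDiff (contDiff_creaseShear₀ hG) _
  have h1 : HasFDerivAt (creaseShear₀ G ∘ fun y : E => (y, (0 : ℝ)))
      ((fderiv ℝ (creaseShear₀ G) (x, 0)).comp (ContinuousLinearMap.inl ℝ E ℝ)) x :=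
    hd.hasFDerivAt.comp x (hasFDerivAt_prodMk_left (𝕜 := ℝ) x (0 : ℝ))
  have h2 : HasFDerivAt (fun y : E => creaseShear₀ G (y, 0)) (ContinuousLinearMap.inl ℝ E ℝ) x := by
    refine (hasFDerivAt_prodMk_left (𝕜 := ℝ) x (0 : ℝ)).congr_of_eventuallyEq ?_
    exact Eventually.of_forall fun y => creaseShear₀_face y
  have h := congrArg (fun L : E →L[ℝ] E × ℝ => L v) (h1.unique h2)
  simpa using h

/-- The normal derivative of the first-order matching shear on the face is the normal column of
`G`: `DF₀ (x, 0) (0, 1) = (c x, a x)`. [folklore] -/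
theorem fderiv_creaseShear₀_apply_inr (hG : ContDiff ℝ ∞ G) (x : E) :
    fderiv ℝ (creaseShear₀ G) (x, 0) (0, 1) = creaseNormal G x := by
  have hd : DifferentiableAt ℝ (creaseShear₀ G) (x, 0) :=
    differentiableAt_of_contDiff (contDiff_creaseShear₀ hG) _
  -- the curve `r ↦ F₀ (x, r)` and its two derivatives at `0`
  have h1 : HasDerivAt (fun r : ℝ => creaseShear₀ G (x, r))
      (fderiv ℝ (creaseShear₀ G) (x, 0) (0, 1)) 0 := by
    have hcurve : HasDerivAt (fun r : ℝ => ((x, r) : E × ℝ)) ((0 : E), (1 : ℝ)) 0 :=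
      (hasDerivAt_const (0 : ℝ) x).prodMk (hasDerivAt_id (0 : ℝ))
    exact hd.hasFDerivAt.comp_hasDerivAt_of_eq (0 : ℝ) hcurve rfl
  have h2 : HasDerivAt (fun r : ℝ => creaseShear₀ G (x, r)) (creaseNormal G x) 0 := by
    have hc : HasDerivAt (fun r : ℝ => x + r • (creaseNormal G x).1) ((creaseNormal G x).1) 0 := by
      simpa using ((hasDerivAt_id (0 : ℝ)).smul_const (creaseNormal G x).1).const_add x
    have ha : HasDerivAt (fun r : ℝ => r * (creaseNormal G x).2) ((creaseNormal G x).2) 0 := by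
      simpa using (hasDerivAt_id (0 : ℝ)).mul_const (creaseNormal G x).2
    have := hc.prodMk ha
    simpa [creaseShear₀] using this
  exact h1.unique h2

/-- **First-order matching**: on the face the derivative of `F₀` IS the derivative of `G`,
`DF₀ (x, 0) = DG (x, 0)` (`x ∈ V`). This is what makes `F₀ - G` vanish to second order on the
face. Campbell–D'Onofrio–Vítek (2026), Lemma 3.1 (there automatic for affine pieces).
[cite: CampbellDonofrioVitek2026, Lemma 3.1] -/
theorem fderiv_creaseShear₀_face (hG : ContDiff ℝ ∞ G) (hV : IsOpen V)
    (hface : ∀ y ∈ V, G (y, 0) = (y, 0)) (hx : x ∈ V) :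
    fderiv ℝ (creaseShear₀ G) (x, 0) = fderiv ℝ G (x, 0) := by
  refine ContinuousLinearMap.ext fun q => ?_
  obtain ⟨v, r⟩ := q
  have hsplit : ((v, r) : E × ℝ) = (v, 0) + r • ((0 : E), (1 : ℝ)) := by
    ext <;> simp
  rw [fderiv_face_apply hG hV hface hx v r, hsplit, map_add, map_smul,
    fderiv_creaseShear₀_apply_inl hG, fderiv_creaseShear₀_apply_inr hG]

/-- The matching defect `Δ = F₀ - G` vanishes on the face (`x ∈ V`). [folklore] -/
theorem creaseShear₀_sub_face (hface : ∀ y ∈ V, G (y, 0) = (y, 0)) (hx : x ∈ V) :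
    creaseShear₀ G (x, 0) - G (x, 0) = 0 := by
  rw [creaseShear₀_face, hface x hx, sub_self]

/-- The derivative of the matching defect `Δ = F₀ - G` vanishes on the face (`x ∈ V`).
[folklore] -/
theorem fderiv_creaseShear₀_sub_face (hG : ContDiff ℝ ∞ G) (hV : IsOpen V)
    (hface : ∀ y ∈ V, G (y, 0) = (y, 0)) (hx : x ∈ V) :
    fderiv ℝ (fun p => creaseShear₀ G p - G p) (x, 0) = 0 := by
  rw [fderiv_fun_sub (differentiableAt_of_contDiff (contDiff_creaseShear₀ hG) _)
    (differentiableAt_of_contDiff hG _), fderiv_creaseShear₀_face hG hV hface hx, sub_self]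

end Face

/-! ### §D Directional derivatives of the shear `F` -/

section Shear

variable {E : Type*} [NormedAddCommGroup E] [NormedSpace ℝ E]
variable {G : E × ℝ → E × ℝ} {L w : ℝ}

/-- **The normal derivative of the shear**: for `p = (x, s)`,
`DF p (0, 1) = (((1 - λ s) - s λ'(s)) • c x, (1 - λ s) a x + λ s + s λ'(s) (1 - a x))`,
`λ = creaseRamp L w`, `λ' = deriv λ`. [folklore] -/
theorem fderiv_creaseShear_apply_inr (hG : ContDiff ℝ ∞ G) (hL : 0 < L) (hw : 0 < w) (x : E)
    (s : ℝ) :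
    fderiv ℝ (creaseShear G L w) (x, s) (0, 1) =
      (((1 - creaseRamp L w s) - s * deriv (creaseRamp L w) s) • (creaseNormal G x).1,
        (1 - creaseRamp L w s) * (creaseNormal G x).2 + creaseRamp L w s +
          s * deriv (creaseRamp L w) s * (1 - (creaseNormal G x).2)) := by
  have hd : DifferentiableAt ℝ (creaseShear G L w) (x, s) :=
    differentiableAt_of_contDiff (contDiff_creaseShear hG hL hw) _
  have h1 : HasDerivAt (fun r : ℝ => creaseShear G L w (x, r))
      (fderiv ℝ (creaseShear G L w) (x, s) (0, 1)) s := by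
    have hcurve : HasDerivAt (fun r : ℝ => ((x, r) : E × ℝ)) ((0 : E), (1 : ℝ)) s :=
      (hasDerivAt_const s x).prodMk (hasDerivAt_id s)
    exact hd.hasFDerivAt.comp_hasDerivAt_of_eq s hcurve rfl
  -- the ramp and its derivative at `s`
  have hl : HasDerivAt (creaseRamp L w) (deriv (creaseRamp L w) s) s :=
    (((contDiff_creaseRamp hL hw).differentiable crease_infty_ne_zero) s).hasDerivAt
  -- the curve `r ↦ F (x, r)` differentiated by the product rules
  have hm : HasDerivAt (fun r : ℝ => r * (1 - creaseRamp L w r))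
      (1 * (1 - creaseRamp L w s) + s * (-deriv (creaseRamp L w) s)) s :=
    (hasDerivAt_id s).fun_mul (hl.const_sub 1)
  have hfst : HasDerivAt (fun r : ℝ => x + (r * (1 - creaseRamp L w r)) • (creaseNormal G x).1)
      ((1 * (1 - creaseRamp L w s) + s * (-deriv (creaseRamp L w) s)) • (creaseNormal G x).1)
      s := by
    have := (hm.smul_const (creaseNormal G x).1).const_add x
    exact this
  have hin : HasDerivAt
      (fun r : ℝ => (1 - creaseRamp L w r) * (creaseNormal G x).2 + creaseRamp L w r)
      ((-deriv (creaseRamp L w) s) * (creaseNormal G x).2 + deriv (creaseRamp L w) s) s :=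
    ((hl.const_sub 1).mul_const _).fun_add hl
  have hsnd : HasDerivAt
      (fun r : ℝ => r * ((1 - creaseRamp L w r) * (creaseNormal G x).2 + creaseRamp L w r))
      (1 * ((1 - creaseRamp L w s) * (creaseNormal G x).2 + creaseRamp L w s) +
        s * ((-deriv (creaseRamp L w) s) * (creaseNormal G x).2 + deriv (creaseRamp L w) s))
      s :=
    (hasDerivAt_id s).fun_mul hin
  have h2 := hfst.prodMk hsnd
  have h12 : fderiv ℝ (creaseShear G L w) (x, s) (0, 1) = _ := h1.unique h2
  rw [h12]
  ext
  · simp only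
    congr 1
    ring
  · simp only
    ring

/-- **The face derivatives of the shear**: for `p = (x, s)`,
`DF p (v, 0) = (v + (s (1 - λ s)) • Dc x v, s (1 - λ s) Da x v)`, where `c`, `a` are the two
components of `creaseNormal G`. [folklore] -/
theorem fderiv_creaseShear_apply_inl (hG : ContDiff ℝ ∞ G) (hL : 0 < L) (hw : 0 < w) (x v : E)
    (s : ℝ) :
    fderiv ℝ (creaseShear G L w) (x, s) (v, 0) =
      (v + (s * (1 - creaseRamp L w s)) • (fderiv ℝ (fun y => (creaseNormal G y).1) x v),
        s * (1 - creaseRamp L w s) * (fderiv ℝ (fun y => (creaseNormal G y).2) x v)) := by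
  set cf : E → E := fun y => (creaseNormal G y).1 with hcf
  set af : E → ℝ := fun y => (creaseNormal G y).2 with haf
  have hcd : HasFDerivAt cf (fderiv ℝ cf x) x :=
    (differentiableAt_of_contDiff (contDiff_creaseNormal hG).fst _).hasFDerivAt
  have had : HasFDerivAt af (fderiv ℝ af x) x :=
    (differentiableAt_of_contDiff (contDiff_creaseNormal hG).snd _).hasFDerivAt
  have hd : DifferentiableAt ℝ (creaseShear G L w) (x, s) :=
    differentiableAt_of_contDiff (contDiff_creaseShear hG hL hw) _
  -- the line `τ ↦ (x + τ v, s)` and the two derivatives of `F` along it at `τ = 0`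
  have hlinE : HasDerivAt (fun τ : ℝ => x + τ • v) v 0 := by
    simpa using ((hasDerivAt_id (0 : ℝ)).smul_const v).const_add x
  have hline : HasDerivAt (fun τ : ℝ => ((x + τ • v, s) : E × ℝ)) ((v, 0) : E × ℝ) 0 := by
    simpa using hlinE.prodMk (hasDerivAt_const (0 : ℝ) s)
  have h1 : HasDerivAt (fun τ : ℝ => creaseShear G L w (x + τ • v, s))
      (fderiv ℝ (creaseShear G L w) (x, s) (v, 0)) 0 := by
    have := hd.hasFDerivAt.comp_hasDerivAt_of_eq (0 : ℝ) hline (by simp)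
    simpa [Function.comp_def] using this
  have hc : HasDerivAt (fun τ : ℝ => cf (x + τ • v)) (fderiv ℝ cf x v) 0 := by
    have := hcd.comp_hasDerivAt_of_eq (0 : ℝ) hlinE (by simp)
    simpa [Function.comp_def] using this
  have ha : HasDerivAt (fun τ : ℝ => af (x + τ • v)) (fderiv ℝ af x v) 0 := by
    have := had.comp_hasDerivAt_of_eq (0 : ℝ) hlinE (by simp)
    simpa [Function.comp_def] using this
  set m : ℝ := s * (1 - creaseRamp L w s) with hm
  have hfst : HasDerivAt (fun τ : ℝ => (x + τ • v) + m • cf (x + τ • v))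
      (v + m • fderiv ℝ cf x v) 0 :=
    hlinE.fun_add (hc.const_smul m)
  have hsnd : HasDerivAt
      (fun τ : ℝ => s * ((1 - creaseRamp L w s) * af (x + τ • v) + creaseRamp L w s))
      (s * ((1 - creaseRamp L w s) * fderiv ℝ af x v + 0)) 0 :=
    ((ha.const_mul _).fun_add (hasDerivAt_const _ _)).const_mul s
  have h2 : HasDerivAt (fun τ : ℝ => creaseShear G L w (x + τ • v, s))
      (v + m • fderiv ℝ cf x v, s * ((1 - creaseRamp L w s) * fderiv ℝ af x v + 0)) 0 := by
    have := hfst.prodMk hsnd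
    simpa [creaseShear, hcf, haf, hm] using this
  rw [h1.unique h2]
  ext
  · rfl
  · simp only
    ring

/-- **The shear displaces by `O(s)`**: `F p - p = ((s (1 - λ s)) • c x, s (1 - λ s) (a x - 1))`.
[folklore] -/
theorem creaseShear_sub_self (x : E) (s : ℝ) :
    creaseShear G L w (x, s) - (x, s) =
      ((s * (1 - creaseRamp L w s)) • (creaseNormal G x).1,
        s * (1 - creaseRamp L w s) * ((creaseNormal G x).2 - 1)) := by
  ext
  · simp [creaseShear]
  · simp only [creaseShear, Prod.snd_sub]
    ring

end Shear

/-! ### §E The blend zone: `g₀ = G + η(s/w) • (F₀ - G)` is `C¹`-close to `DG (x, 0)` -/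

section Blend

variable {E : Type*} [NormedAddCommGroup E] [NormedSpace ℝ E]
variable {G : E × ℝ → E × ℝ} {V K₁ : Set E} {L w : ℝ}

/-- The blend `g₀ = creaseBlend₀ G w = G + η(s/w) • (F₀ - G)` of `G` with the first-order
matching shear (the smoothed crease on `{s ≤ 2w}`, `creaseMap_eq_blend₀`). [folklore] -/
def creaseBlend₀ (G : E × ℝ → E × ℝ) (w : ℝ) (p : E × ℝ) : E × ℝ :=
  G p + smoothTransition (p.2 / w) • (creaseShear₀ G p - G p)

/-- The blend is `C^∞`. [folklore] -/
theorem contDiff_creaseBlend₀ (hG : ContDiff ℝ ∞ G) (w : ℝ) : ContDiff ℝ ∞ (creaseBlend₀ G w) :=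
  contDiff_blend₀ hG w

/-- The smoothed crease agrees with the blend near every point of `{s < 2w}`. [folklore] -/
theorem creaseMap_eventuallyEq_creaseBlend₀ (hL : 0 < L) (hw : 0 < w) {p : E × ℝ}
    (hp : p.2 < 2 * w) : creaseMap G L w =ᶠ[𝓝 p] creaseBlend₀ G w := by
  have ho : IsOpen {q : E × ℝ | q.2 < 2 * w} := isOpen_lt continuous_snd continuous_const
  filter_upwards [ho.mem_nhds hp] with q hq
  exact creaseMap_eq_blend₀ hL hw (le_of_lt hq)

/-- The smoothed crease agrees with the shear near every point of `{s > w}`. [folklore] -/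
theorem creaseMap_eventuallyEq_creaseShear (hw : 0 < w) {p : E × ℝ} (hp : w < p.2) :
    creaseMap G L w =ᶠ[𝓝 p] creaseShear G L w := by
  have ho : IsOpen {q : E × ℝ | w < q.2} := isOpen_lt continuous_const continuous_snd
  filter_upwards [ho.mem_nhds hp] with q hq
  exact creaseMap_of_le hw (le_of_lt hq)

/-- On `{s < 2w}` the derivative of the smoothed crease is that of the blend. [folklore] -/
theorem fderiv_creaseMap_of_lt (hL : 0 < L) (hw : 0 < w) {p : E × ℝ} (hp : p.2 < 2 * w) :
    fderiv ℝ (creaseMap G L w) p = fderiv ℝ (creaseBlend₀ G w) p :=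
  (creaseMap_eventuallyEq_creaseBlend₀ hL hw hp).fderiv_eq

/-- On `{s > w}` the derivative of the smoothed crease is that of the shear. [folklore] -/
theorem fderiv_creaseMap_of_gt (hw : 0 < w) {p : E × ℝ} (hp : w < p.2) :
    fderiv ℝ (creaseMap G L w) p = fderiv ℝ (creaseShear G L w) p :=
  (creaseMap_eventuallyEq_creaseShear hw hp).fderiv_eq

/-- The derivative of the cutoff factor `q ↦ η(q.2 / w)`. [folklore] -/
theorem hasFDerivAt_eta (w : ℝ) (p : E × ℝ) :
    HasFDerivAt (fun q : E × ℝ => smoothTransition (q.2 / w))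
      ((deriv smoothTransition (p.2 / w) / w) • ContinuousLinearMap.snd ℝ E ℝ) p := by
  have h1 : HasDerivAt (fun t : ℝ => smoothTransition (t / w))
      (deriv smoothTransition (p.2 / w) / w) p.2 := by
    have hη : HasDerivAt smoothTransition (deriv smoothTransition (p.2 / w)) (p.2 / w) :=
      ((smoothTransition.contDiff (n := 1)).differentiable one_ne_zero _).hasDerivAt
    have := HasDerivAt.comp (h₂ := smoothTransition) (h := fun t : ℝ => t / w) p.2 hη
      ((hasDerivAt_id p.2).div_const w)
    exact this.congr_deriv (by ring)
  exact h1.comp_hasFDerivAt p hasFDerivAt_snd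

/-- **The derivative of the blend**:
`Dg₀ p = DG p + η(s/w) • DΔ p + (η'(s/w)/w • snd).smulRight (Δ p)`, `Δ = F₀ - G`. [folklore] -/
theorem hasFDerivAt_creaseBlend₀ (hG : ContDiff ℝ ∞ G) (w : ℝ) (p : E × ℝ) :
    HasFDerivAt (creaseBlend₀ G w)
      (fderiv ℝ G p +
        (smoothTransition (p.2 / w) • fderiv ℝ (fun q => creaseShear₀ G q - G q) p +
          ((deriv smoothTransition (p.2 / w) / w) • ContinuousLinearMap.snd ℝ E ℝ).smulRight
            (creaseShear₀ G p - G p))) p := by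
  have hGd : HasFDerivAt G (fderiv ℝ G p) p := (differentiableAt_of_contDiff hG p).hasFDerivAt
  have hΔ : HasFDerivAt (fun q => creaseShear₀ G q - G q)
      (fderiv ℝ (fun q => creaseShear₀ G q - G q) p) p :=
    (differentiableAt_of_contDiff ((contDiff_creaseShear₀ hG).sub hG) p).hasFDerivAt
  exact hGd.add ((hasFDerivAt_eta w p).smul hΔ)

/-- **Mean value inequality along a normal segment**: if `‖Dφ‖ ≤ C` on `{x} × [0, T]` then
`‖φ (x, s) - φ (x, 0)‖ ≤ C s` for `s ∈ [0, T]`. [folklore] -/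
theorem norm_sub_le_of_vertical {F' : Type*} [NormedAddCommGroup F'] [NormedSpace ℝ F']
    {φ : E × ℝ → F'} {x : E} {T C : ℝ}
    (hφ : ∀ q ∈ ({x} : Set E) ×ˢ Icc (0 : ℝ) T, DifferentiableAt ℝ φ q)
    (hC : ∀ q ∈ ({x} : Set E) ×ˢ Icc (0 : ℝ) T, ‖fderiv ℝ φ q‖ ≤ C) {s : ℝ}
    (hs : s ∈ Icc (0 : ℝ) T) : ‖φ (x, s) - φ (x, 0)‖ ≤ C * s := by
  have hconv : Convex ℝ (({x} : Set E) ×ˢ Icc (0 : ℝ) T) :=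
    (convex_singleton x).prod (convex_Icc 0 T)
  have h0 : ((x, 0) : E × ℝ) ∈ ({x} : Set E) ×ˢ Icc (0 : ℝ) T :=
    ⟨mem_singleton x, ⟨le_rfl, hs.1.trans hs.2⟩⟩
  have h1 : ((x, s) : E × ℝ) ∈ ({x} : Set E) ×ˢ Icc (0 : ℝ) T := ⟨mem_singleton x, hs⟩
  have h := hconv.norm_image_sub_le_of_norm_fderiv_le hφ hC h0 h1
  have hn : ‖((x, s) : E × ℝ) - (x, 0)‖ = s := by
    rw [Prod.mk_sub_mk, sub_self, sub_zero, Prod.norm_mk, norm_zero, Real.norm_of_nonneg hs.1,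
      max_eq_right hs.1]
  rwa [hn] at h

/-- A bound for a continuous function on a compact set, nonnegative (bookkeeping around
`IsCompact.exists_bound_of_continuousOn`). [folklore] -/
theorem exists_nonneg_bound {X F' : Type*} [TopologicalSpace X] [NormedAddCommGroup F']
    {S : Set X} (hS : IsCompact S) {φ : X → F'} (hφ : ContinuousOn φ S) :
    ∃ C : ℝ, 0 ≤ C ∧ ∀ q ∈ S, ‖φ q‖ ≤ C := by
  obtain ⟨C, hC⟩ := hS.exists_bound_of_continuousOn hφ
  exact ⟨max C 0, le_max_right _ _, fun q hq => (hC q hq).trans (le_max_left _ _)⟩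

/-- **The blend is `C¹`-close to the face derivative and `C⁰`-close to the identity.** For a
compact `K₁ ⊆ V` there is `M` such that for all `0 < w ≤ 1/2`, `x ∈ K₁`, `s ∈ [0, 2w]`:
`‖Dg₀ (x, s) - DG (x, 0)‖ ≤ M w` and `‖g₀ (x, s) - (x, s)‖ ≤ M w`.  The three terms of
`Dg₀ - DG (x,0)` are `DG (x,s) - DG (x,0) = O(s)`, `η • DΔ = O(s)` (since `DΔ (x, 0) = 0`) and
`η'(s/w)/w • Δ = O(s²/w)` (since `Δ (x, 0) = 0` and `DΔ = O(s)`), all by the mean value inequality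
along normal segments from second-derivative bounds on the compact set `K₁ × [0, 1]`.
Campbell–D'Onofrio–Vítek (2026), Lemma 3.1, estimates (3.3)–(3.6).
[cite: CampbellDonofrioVitek2026, Lemma 3.1] -/
theorem exists_blend_bound (hG : ContDiff ℝ ∞ G) (hV : IsOpen V)
    (hface : ∀ y ∈ V, G (y, 0) = (y, 0)) (hK₁ : IsCompact K₁) (hK₁V : K₁ ⊆ V) :
    ∃ M : ℝ, 0 ≤ M ∧ ∀ w : ℝ, 0 < w → 2 * w ≤ 1 → ∀ x ∈ K₁, ∀ s ∈ Icc (0 : ℝ) (2 * w),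
      ‖fderiv ℝ (creaseBlend₀ G w) (x, s) - fderiv ℝ G (x, 0)‖ ≤ M * w ∧
        ‖creaseBlend₀ G w (x, s) - (x, s)‖ ≤ M * w := by
  -- the defect `Δ = F₀ - G` and the compact set `S = K₁ × [0, 1]`
  set Δ : E × ℝ → E × ℝ := fun q => creaseShear₀ G q - G q with hΔdef
  have hΔ : ContDiff ℝ ∞ Δ := (contDiff_creaseShear₀ hG).sub hG
  set S : Set (E × ℝ) := K₁ ×ˢ Icc (0 : ℝ) 1 with hSdef
  have hS : IsCompact S := hK₁.prod isCompact_Icc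
  -- continuous first and second derivatives
  have hG1 : ContDiff ℝ ∞ (fderiv ℝ G) := (contDiff_infty_iff_fderiv.1 hG).2
  have hG2 : ContDiff ℝ ∞ (fderiv ℝ (fderiv ℝ G)) := (contDiff_infty_iff_fderiv.1 hG1).2
  have hΔ1 : ContDiff ℝ ∞ (fderiv ℝ Δ) := (contDiff_infty_iff_fderiv.1 hΔ).2
  have hΔ2 : ContDiff ℝ ∞ (fderiv ℝ (fderiv ℝ Δ)) := (contDiff_infty_iff_fderiv.1 hΔ1).2
  -- bounds on `S`
  obtain ⟨M₀, hM₀, hM₀b⟩ := exists_nonneg_bound hS hG1.continuous.continuousOn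
  obtain ⟨M₁, hM₁, hM₁b⟩ := exists_nonneg_bound hS hG2.continuous.continuousOn
  obtain ⟨M₂, hM₂, hM₂b⟩ := exists_nonneg_bound hS hΔ2.continuous.continuousOn
  set Cη : ℝ := smoothTransitionDerivBound with hCη
  have hCη0 : 0 < Cη := smoothTransitionDerivBound_pos
  refine ⟨2 * M₁ + 2 * M₂ + 4 * Cη * M₂ + (2 * M₀ + 2 + 4 * M₂), by positivity,
    fun w hw hw1 x hx s hs => ?_⟩
  have hs0 : 0 ≤ s := hs.1
  have hs1 : s ≤ 1 := hs.2.trans hw1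
  have hsw : s ≤ 2 * w := hs.2
  have hxV : x ∈ V := hK₁V hx
  -- membership of the normal segment in `S`
  have hseg : ∀ {T : ℝ}, T ≤ 1 → ({x} : Set E) ×ˢ Icc (0 : ℝ) T ⊆ S := by
    intro T hT q hq
    obtain ⟨hq1, hq2⟩ := hq
    rw [mem_singleton_iff] at hq1
    exact ⟨hq1 ▸ hx, ⟨hq2.1, hq2.2.trans hT⟩⟩
  -- (i) `‖DG (x,s) - DG (x,0)‖ ≤ M₁ s`
  have hi : ‖fderiv ℝ G (x, s) - fderiv ℝ G (x, 0)‖ ≤ M₁ * s :=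
    norm_sub_le_of_vertical (T := 1) (fun q _ => differentiableAt_of_contDiff hG1 q)
      (fun q hq => hM₁b q (hseg le_rfl hq)) ⟨hs0, hs1⟩
  -- (ii) `‖DΔ (x,s)‖ ≤ M₂ s`
  have hii' : ∀ s' ∈ Icc (0 : ℝ) 1, ‖fderiv ℝ Δ (x, s')‖ ≤ M₂ * s' := by
    intro s' hs'
    have h := norm_sub_le_of_vertical (T := 1) (fun q _ => differentiableAt_of_contDiff hΔ1 q)
      (fun q hq => hM₂b q (hseg le_rfl hq)) hs'
    rwa [hΔdef, fderiv_creaseShear₀_sub_face hG hV hface hxV, sub_zero] at h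
  have hii : ‖fderiv ℝ Δ (x, s)‖ ≤ M₂ * s := hii' s ⟨hs0, hs1⟩
  -- (iii) `‖Δ (x,s)‖ ≤ (M₂ (2w)) s`
  have hiii : ‖Δ (x, s)‖ ≤ M₂ * (2 * w) * s := by
    have h := norm_sub_le_of_vertical (T := 2 * w) (φ := Δ) (x := x) (C := M₂ * (2 * w))
      (fun q _ => differentiableAt_of_contDiff hΔ q)
      (fun q hq => ?_) ⟨hs0, hsw⟩
    · have h0 : Δ (x, 0) = 0 := creaseShear₀_sub_face hface hxV
      rwa [h0, sub_zero] at h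
    · obtain ⟨hq1, hq2⟩ := hq
      rw [mem_singleton_iff] at hq1
      have : q = (x, q.2) := Prod.ext hq1 rfl
      rw [this]
      exact (hii' q.2 ⟨hq2.1, hq2.2.trans hw1⟩).trans (by nlinarith [hq2.2])
  -- (iv) `‖G (x,s) - (x,s)‖ ≤ (M₀ + 1) s`
  have hiv : ‖G (x, s) - (x, s)‖ ≤ (M₀ + 1) * s := by
    have h := norm_sub_le_of_vertical (T := 1) (φ := G) (fun q _ => differentiableAt_of_contDiff hG q)
      (fun q hq => hM₀b q (hseg le_rfl hq)) ⟨hs0, hs1⟩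
    rw [hface x hxV] at h
    have hn : ‖((x, 0) : E × ℝ) - (x, s)‖ = s := by
      rw [Prod.mk_sub_mk, sub_self, zero_sub, Prod.norm_mk, norm_zero, norm_neg,
        Real.norm_of_nonneg hs0, max_eq_right hs0]
    calc ‖G (x, s) - (x, s)‖ ≤ ‖G (x, s) - (x, 0)‖ + ‖((x, 0) : E × ℝ) - (x, s)‖ :=
          norm_sub_le_norm_sub_add_norm_sub _ _ _
      _ ≤ M₀ * s + s := by rw [hn]; exact add_le_add h le_rfl
      _ = (M₀ + 1) * s := by ring
  -- the cutoff factor and its derivative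
  have hη01 : |smoothTransition (s / w)| ≤ 1 := by
    rw [abs_of_nonneg (smoothTransition.nonneg _)]
    exact smoothTransition.le_one _
  have hη' : ‖(deriv smoothTransition (s / w) / w) • ContinuousLinearMap.snd ℝ E ℝ‖ ≤ Cη / w := by
    refine (norm_smul_le (deriv smoothTransition (s / w) / w) (ContinuousLinearMap.snd ℝ E ℝ)).trans ?_
    rw [norm_div, Real.norm_of_nonneg hw.le]
    calc ‖deriv smoothTransition (s / w)‖ / w * ‖ContinuousLinearMap.snd ℝ E ℝ‖
        ≤ Cη / w * 1 := by
          gcongr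
          · exact norm_deriv_smoothTransition_le _
          · exact ContinuousLinearMap.norm_snd_le ℝ E ℝ
      _ = Cη / w := mul_one _
  constructor
  · -- the derivative estimate
    rw [(hasFDerivAt_creaseBlend₀ hG w (x, s)).fderiv]
    have hsplit : fderiv ℝ G (x, s) +
          (smoothTransition (s / w) • fderiv ℝ Δ (x, s) +
            ((deriv smoothTransition (s / w) / w) • ContinuousLinearMap.snd ℝ E ℝ).smulRight
              (Δ (x, s))) - fderiv ℝ G (x, 0) =
        (fderiv ℝ G (x, s) - fderiv ℝ G (x, 0)) + smoothTransition (s / w) • fderiv ℝ Δ (x, s) +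
          ((deriv smoothTransition (s / w) / w) • ContinuousLinearMap.snd ℝ E ℝ).smulRight
            (Δ (x, s)) := by abel
    rw [show ((x, s) : E × ℝ).2 = s from rfl, hsplit]
    refine (norm_add₃_le).trans ?_
    have h2 : ‖smoothTransition (s / w) • fderiv ℝ Δ (x, s)‖ ≤ M₂ * s := by
      refine (norm_smul_le (smoothTransition (s / w)) (fderiv ℝ Δ (x, s))).trans ?_
      rw [Real.norm_eq_abs]
      calc |smoothTransition (s / w)| * ‖fderiv ℝ Δ (x, s)‖ ≤ 1 * (M₂ * s) := by gcongr
        _ = M₂ * s := one_mul _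
    have h3 : ‖((deriv smoothTransition (s / w) / w) • ContinuousLinearMap.snd ℝ E ℝ).smulRight
        (Δ (x, s))‖ ≤ 4 * Cη * M₂ * w := by
      rw [ContinuousLinearMap.norm_smulRight_apply]
      calc ‖(deriv smoothTransition (s / w) / w) • ContinuousLinearMap.snd ℝ E ℝ‖ * ‖Δ (x, s)‖
          ≤ (Cη / w) * (M₂ * (2 * w) * s) := by gcongr
        _ = 2 * Cη * M₂ * s := by field_simp
        _ ≤ 2 * Cη * M₂ * (2 * w) := by gcongr
        _ = 4 * Cη * M₂ * w := by ring
    calc ‖fderiv ℝ G (x, s) - fderiv ℝ G (x, 0)‖ + ‖smoothTransition (s / w) • fderiv ℝ Δ (x, s)‖ +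
          ‖((deriv smoothTransition (s / w) / w) • ContinuousLinearMap.snd ℝ E ℝ).smulRight
            (Δ (x, s))‖
        ≤ M₁ * s + M₂ * s + 4 * Cη * M₂ * w := by gcongr
      _ ≤ M₁ * (2 * w) + M₂ * (2 * w) + 4 * Cη * M₂ * w := by gcongr
      _ ≤ (2 * M₁ + 2 * M₂ + 4 * Cη * M₂ + (2 * M₀ + 2 + 4 * M₂)) * w := by
          nlinarith [hw.le, mul_nonneg hM₀ hw.le, mul_nonneg hM₂ hw.le]
  · -- the `C⁰` estimate
    have h : creaseBlend₀ G w (x, s) - (x, s) =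
        (G (x, s) - (x, s)) + smoothTransition (s / w) • Δ (x, s) := by
      simp only [creaseBlend₀, hΔdef]
      abel
    rw [h]
    refine (norm_add_le _ _).trans ?_
    have h2 : ‖smoothTransition (s / w) • Δ (x, s)‖ ≤ M₂ * (2 * w) * s := by
      refine (norm_smul_le _ _).trans ?_
      rw [Real.norm_eq_abs]
      calc |smoothTransition (s / w)| * ‖Δ (x, s)‖ ≤ 1 * (M₂ * (2 * w) * s) := by gcongr
        _ = M₂ * (2 * w) * s := one_mul _
    calc ‖G (x, s) - (x, s)‖ + ‖smoothTransition (s / w) • Δ (x, s)‖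
        ≤ (M₀ + 1) * s + M₂ * (2 * w) * s := add_le_add hiv h2
      _ ≤ (M₀ + 1) * (2 * w) + M₂ * (2 * w) * 1 := by gcongr
      _ ≤ (2 * M₁ + 2 * M₂ + 4 * Cη * M₂ + (2 * M₀ + 2 + 4 * M₂)) * w := by
          nlinarith [hw.le, mul_nonneg hM₁ hw.le, mul_nonneg hM₂ hw.le,
            mul_nonneg (mul_nonneg hCη0.le hM₂) hw.le]

end Blend

/-! ### §F Assembly: the estimates for the smoothed crease -/

section Main

variable {E : Type*} [NormedAddCommGroup E] [NormedSpace ℝ E] [FiniteDimensional ℝ E]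
variable {G : E × ℝ → E × ℝ} {V K : Set E}

/-- A continuous positive function on a compact set is bounded below by a positive constant
(also when the set is empty). [folklore] -/
theorem exists_pos_le_of_isCompact {X : Type*} [TopologicalSpace X] {S : Set X}
    (hS : IsCompact S) {φ : X → ℝ} (hφ : ContinuousOn φ S) (hpos : ∀ q ∈ S, 0 < φ q) :
    ∃ m : ℝ, 0 < m ∧ ∀ q ∈ S, m ≤ φ q := by
  rcases S.eq_empty_or_nonempty with h | h
  · refine ⟨1, one_pos, fun q hq => ?_⟩
    rw [h] at hq
    exact absurd hq (notMem_empty q)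
  · obtain ⟨q₀, hq₀, hmin⟩ := hS.exists_isMinOn h hφ
    exact ⟨φ q₀, hpos q₀ hq₀, fun q hq => hmin hq⟩

omit [NormedSpace ℝ E] [FiniteDimensional ℝ E] in
/-- The norm of `(v, 0) : E × ℝ` is `‖v‖`. [folklore] -/
theorem norm_prodMk_zero_eq (v : E) : ‖((v, 0) : E × ℝ)‖ = ‖v‖ := by
  rw [Prod.norm_mk, norm_zero, max_eq_left (norm_nonneg v)]

omit [NormedSpace ℝ E] [FiniteDimensional ℝ E] in
/-- The norm of `(0, 1) : E × ℝ` is `1`. [folklore] -/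
theorem norm_zero_prodMk_one : ‖((0, 1) : E × ℝ)‖ = 1 := by
  rw [Prod.norm_mk, norm_zero, norm_one, max_eq_right zero_le_one]

/-- **The estimates for the smoothed crease, with prescribed constants.** As
`exists_creaseMap_estimates`, but the record constants are EXPLICIT in terms of given bounds of
the crease normal on `V`: if `aS ≤ (creaseNormal G x).2`, `‖(creaseNormal G x).2‖ ≤ AS` and
`‖(creaseNormal G x).1‖ ≤ CS` for all `x ∈ V` (`aS > 0`; positivity of the normal is implied),
the record holds with
`a₀ = min aS 1 / 2`, `A₀ = AS + 2`, `C₀ = 2 CS + 1`.  (This lets the sweep feed margin-free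
bounds.) [cite: CampbellDonofrioVitek2026, Lemma 3.1] -/
theorem exists_creaseMap_estimates_of_bounds (hG : ContDiff ℝ ∞ G) (hK : IsCompact K)
    (hV : IsOpen V) (hKV : K ⊆ V) (hface : ∀ x ∈ V, G (x, 0) = (x, 0))
    {aS AS CS : ℝ} (haS : 0 < aS) (hAS : 0 ≤ AS)
    (hCS : 0 ≤ CS) (haSb : ∀ x ∈ V, aS ≤ (creaseNormal G x).2)
    (hASb : ∀ x ∈ V, ‖(creaseNormal G x).2‖ ≤ AS) (hCSb : ∀ x ∈ V, ‖(creaseNormal G x).1‖ ≤ CS) :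
    ∃ V' : Set E, IsOpen V' ∧ K ⊆ V' ∧
      ∀ ε : ℝ, 0 < ε → ∃ L w : ℝ, 0 < L ∧ 0 < w ∧ 2 * w * exp L ≤ ε ∧
        ∀ p : E × ℝ, p.1 ∈ V' → p.2 ∈ Icc 0 (2 * w * exp L) →
          ‖creaseMap G L w p - p‖ ≤ ε ∧
          (∀ v : E, ‖fderiv ℝ (creaseMap G L w) p (v, 0) - (v, 0)‖ ≤ ε * ‖v‖) ∧
          min aS 1 / 2 ≤ (fderiv ℝ (creaseMap G L w) p (0, 1)).2 ∧
          (fderiv ℝ (creaseMap G L w) p (0, 1)).2 ≤ AS + 2 ∧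
          ‖(fderiv ℝ (creaseMap G L w) p (0, 1)).1‖ ≤ 2 * CS + 1 := by
  -- a neighbourhood `V'` of `K` with compact closure `K₁ ⊆ V`
  obtain ⟨V', hV'o, hKV', hclV, hK₁⟩ := exists_open_between_and_isCompact_closure hK hV hKV
  set K₁ : Set E := closure V' with hK₁def
  have hK₁V : K₁ ⊆ V := hclV
  have hV'K₁ : V' ⊆ K₁ := subset_closure
  -- the first-order data `c`, `a` and their derivatives, bounded on `K₁`
  set cf : E → E := fun y => (creaseNormal G y).1 with hcf
  set af : E → ℝ := fun y => (creaseNormal G y).2 with haf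
  have hcf_smooth : ContDiff ℝ ∞ cf := (contDiff_creaseNormal hG).fst
  have haf_smooth : ContDiff ℝ ∞ af := (contDiff_creaseNormal hG).snd
  have hCc : 0 ≤ CS := hCS
  have hCcb : ∀ y ∈ K₁, ‖cf y‖ ≤ CS := fun y hy => hCSb y (hK₁V hy)
  have hCa : 0 ≤ AS := hAS
  have hCab : ∀ y ∈ K₁, ‖af y‖ ≤ AS := fun y hy => hASb y (hK₁V hy)
  obtain ⟨D, hD, hDb⟩ := exists_nonneg_bound hK₁
    (φ := fun y => 1 - af y) (contDiff_const.sub haf_smooth).continuous.continuousOn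
  obtain ⟨Sc, hSc, hScb⟩ := exists_nonneg_bound hK₁
    (contDiff_infty_iff_fderiv.1 hcf_smooth).2.continuous.continuousOn
  obtain ⟨Sa, hSa, hSab⟩ := exists_nonneg_bound hK₁
    (contDiff_infty_iff_fderiv.1 haf_smooth).2.continuous.continuousOn
  have hamin : 0 < aS := haS
  have haminb : ∀ y ∈ K₁, aS ≤ af y := fun y hy => haSb y (hK₁V hy)
  -- the blend constant
  obtain ⟨M, hM, hMb⟩ := exists_blend_bound hG hV hface hK₁ hK₁V
  -- the constants
  obtain ⟨am, ham⟩ : ∃ am : ℝ, am = min aS 1 := ⟨_, rfl⟩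
  have ham0 : 0 < am := by rw [ham]; exact lt_min hamin one_pos
  have ham1 : am ≤ 1 := by rw [ham]; exact min_le_right _ _
  have hama : ∀ y ∈ K₁, am ≤ af y := fun y hy => by
    rw [ham]; exact (min_le_left _ _).trans (haminb y hy)
  refine ⟨V', hV'o, hKV', fun ε hε => ?_⟩
  -- the slowness `θ₀` and the ramp parameter `L`
  obtain ⟨θ₀, hθ₀⟩ : ∃ θ₀ : ℝ, θ₀ = am / (2 * (D + 1)) := ⟨_, rfl⟩
  have hθ₀0 : 0 < θ₀ := by rw [hθ₀]; positivity
  have hθ₀D : θ₀ * D ≤ am / 2 := by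
    rw [hθ₀, div_mul_eq_mul_div, div_le_div_iff₀ (by positivity) (by positivity)]
    nlinarith [ham0.le, hD]
  have hθ₀1 : θ₀ ≤ 1 := by
    rw [hθ₀, div_le_one (by positivity)]
    nlinarith [hD]
  obtain ⟨L, hLdef⟩ : ∃ L : ℝ, L = max 1 (smoothTransitionDerivBound / θ₀) := ⟨_, rfl⟩
  have hL : 0 < L := by rw [hLdef]; exact lt_of_lt_of_le one_pos (le_max_left _ _)
  have hLθ : smoothTransitionDerivBound / θ₀ ≤ L := by rw [hLdef]; exact le_max_right _ _
  -- the widths: `W ≤ Wmax`, `w` small for the blend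
  obtain ⟨Wmax, hWmax⟩ : ∃ Wmax : ℝ,
      Wmax = min (min ε 1) (min (ε / (Sc + Sa + 1)) (ε / (CS + D + 1))) := ⟨_, rfl⟩
  have hWmax0 : 0 < Wmax := by rw [hWmax]; positivity
  have hWmaxε : Wmax ≤ ε := by rw [hWmax]; exact (min_le_left _ _).trans (min_le_left _ _)
  have hWmax1 : Wmax ≤ 1 := by rw [hWmax]; exact (min_le_left _ _).trans (min_le_right _ _)
  have hWmaxS : Wmax ≤ ε / (Sc + Sa + 1) := by
    rw [hWmax]; exact (min_le_right _ _).trans (min_le_left _ _)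
  have hWmaxC : Wmax ≤ ε / (CS + D + 1) := by
    rw [hWmax]; exact (min_le_right _ _).trans (min_le_right _ _)
  obtain ⟨w, hwdef⟩ : ∃ w : ℝ,
      w = min (min (Wmax * exp (-L) / 2) (1 / 4)) (min (ε / (M + 1)) (am / (2 * (M + 1)))) :=
    ⟨_, rfl⟩
  have hw : 0 < w := by rw [hwdef]; positivity
  have hw14 : w ≤ 1 / 4 := by rw [hwdef]; exact (min_le_left _ _).trans (min_le_right _ _)
  have hw1 : 2 * w ≤ 1 := by linarith only [hw14]
  have hwW : w ≤ Wmax * exp (-L) / 2 := by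
    rw [hwdef]; exact (min_le_left _ _).trans (min_le_left _ _)
  have hwε : w ≤ ε / (M + 1) := by rw [hwdef]; exact (min_le_right _ _).trans (min_le_left _ _)
  have hwam : w ≤ am / (2 * (M + 1)) := by
    rw [hwdef]; exact (min_le_right _ _).trans (min_le_right _ _)
  have hMwε : M * w ≤ ε := by
    have h1 : M * w ≤ M * (ε / (M + 1)) := mul_le_mul_of_nonneg_left hwε hM
    have h2 : M * (ε / (M + 1)) ≤ ε := by
      rw [mul_div_assoc', div_le_iff₀ (by positivity)]
      nlinarith only [hM, hε]
    exact h1.trans h2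
  have hMwam : M * w ≤ am / 2 := by
    have h1 : M * w ≤ M * (am / (2 * (M + 1))) := mul_le_mul_of_nonneg_left hwam hM
    have h2 : M * (am / (2 * (M + 1))) ≤ am / 2 := by
      rw [mul_div_assoc', div_le_div_iff₀ (by positivity) (by positivity)]
      nlinarith only [ham0, hM]
    exact h1.trans h2
  -- the layer width `W = 2 w e^L ≤ Wmax`
  obtain ⟨W, hWdef⟩ : ∃ W : ℝ, W = 2 * w * exp L := ⟨_, rfl⟩
  have hWle : W ≤ Wmax := by
    have h1 : W ≤ 2 * (Wmax * exp (-L) / 2) * exp L := by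
      rw [hWdef]; gcongr
    have hee : exp (-L) * exp L = 1 := by
      rw [Real.exp_neg, inv_mul_cancel₀ (exp_pos L).ne']
    have h2 : 2 * (Wmax * exp (-L) / 2) * exp L = Wmax := by
      calc 2 * (Wmax * exp (-L) / 2) * exp L = Wmax * (exp (-L) * exp L) := by ring
        _ = Wmax := by rw [hee, mul_one]
    linarith only [h1, h2]
  have hW0 : 0 ≤ W := by rw [hWdef]; positivity
  have hWε : W ≤ ε := hWle.trans hWmaxε
  have hW1 : W ≤ 1 := hWle.trans hWmax1
  have hWS : W * (Sc + Sa) ≤ ε := by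
    have h1 : W ≤ ε / (Sc + Sa + 1) := hWle.trans hWmaxS
    rw [le_div_iff₀ (by positivity)] at h1
    nlinarith only [h1, hW0, hSc, hSa]
  have hWC : W * (CS + D) ≤ ε := by
    have h1 : W ≤ ε / (CS + D + 1) := hWle.trans hWmaxC
    rw [le_div_iff₀ (by positivity)] at h1
    nlinarith only [h1, hW0, hCc, hD]
  refine ⟨L, w, hL, hw, hWdef ▸ hWε, fun p hp1 hp2 => ?_⟩
  rw [← hWdef] at hp2
  obtain ⟨x, s⟩ := p
  simp only at hp1 hp2
  have hxK₁ : x ∈ K₁ := hV'K₁ hp1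
  have hxV : x ∈ V := hK₁V hxK₁
  have hs0 : 0 ≤ s := hp2.1
  have hsW : s ≤ W := hp2.2
  -- data bounds at `x`
  have hax : am ≤ af x := hama x hxK₁
  have hCax : |af x| ≤ AS := by simpa [Real.norm_eq_abs] using hCab x hxK₁
  have hDx : |1 - af x| ≤ D := by simpa [Real.norm_eq_abs] using hDb x hxK₁
  have hCcx : ‖cf x‖ ≤ CS := hCcb x hxK₁
  by_cases hcase : s < 2 * w
  · ---------------------------------------------------------------- the blend zone
    have hs2w : s ∈ Icc (0 : ℝ) (2 * w) := ⟨hs0, hcase.le⟩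
    obtain ⟨hDer, hC0⟩ := hMb w hw hw1 x hxK₁ s hs2w
    have hfd : fderiv ℝ (creaseMap G L w) (x, s) = fderiv ℝ (creaseBlend₀ G w) (x, s) :=
      fderiv_creaseMap_of_lt hL hw hcase
    have hval : creaseMap G L w (x, s) = creaseBlend₀ G w (x, s) :=
      creaseMap_eq_blend₀ hL hw hcase.le
    set Lp := fderiv ℝ (creaseBlend₀ G w) (x, s) with hLp
    set L0 := fderiv ℝ G (x, 0) with hL0
    have hL0v : ∀ v : E, L0 (v, 0) = (v, 0) := fun v => fderiv_apply_inl_of_face hG hV hface hxV v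
    have hL0n : L0 (0, 1) = creaseNormal G x := rfl
    refine ⟨?_, ?_, ?_, ?_, ?_⟩
    · rw [hval]; exact hC0.trans hMwε
    · intro v
      rw [hfd]
      have h : Lp (v, 0) - (v, 0) = (Lp - L0) (v, 0) := by
        calc Lp (v, 0) - (v, 0) = Lp (v, 0) - L0 (v, 0) := by rw [hL0v]
          _ = (Lp - L0) (v, 0) := rfl
      rw [h]
      calc ‖(Lp - L0) (v, 0)‖ ≤ ‖Lp - L0‖ * ‖((v, 0) : E × ℝ)‖ := (Lp - L0).le_opNorm _
        _ ≤ M * w * ‖v‖ := by rw [norm_prodMk_zero_eq]; gcongr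
        _ ≤ ε * ‖v‖ := by gcongr
    · rw [hfd]
      have h : (Lp (0, 1)).2 = af x + ((Lp - L0) (0, 1)).2 := by
        have e : (Lp - L0) (0, 1) = Lp (0, 1) - L0 (0, 1) := rfl
        rw [e, Prod.snd_sub, hL0n]
        show (Lp (0, 1)).2 = (creaseNormal G x).2 + ((Lp (0, 1)).2 - (creaseNormal G x).2)
        ring
      rw [h]
      have hb : |((Lp - L0) (0, 1)).2| ≤ M * w := by
        calc |((Lp - L0) (0, 1)).2| = ‖((Lp - L0) (0, 1)).2‖ := (Real.norm_eq_abs _).symm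
          _ ≤ ‖(Lp - L0) (0, 1)‖ := norm_snd_le _
          _ ≤ ‖Lp - L0‖ * ‖((0, 1) : E × ℝ)‖ := (Lp - L0).le_opNorm _
          _ ≤ M * w * 1 := by rw [norm_zero_prodMk_one]; gcongr
          _ = M * w := mul_one _
      have := (abs_le.1 hb).1
      linarith
    · rw [hfd]
      have h : (Lp (0, 1)).2 = af x + ((Lp - L0) (0, 1)).2 := by
        have e : (Lp - L0) (0, 1) = Lp (0, 1) - L0 (0, 1) := rfl
        rw [e, Prod.snd_sub, hL0n]
        show (Lp (0, 1)).2 = (creaseNormal G x).2 + ((Lp (0, 1)).2 - (creaseNormal G x).2)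
        ring
      rw [h]
      have hb : |((Lp - L0) (0, 1)).2| ≤ M * w := by
        calc |((Lp - L0) (0, 1)).2| = ‖((Lp - L0) (0, 1)).2‖ := (Real.norm_eq_abs _).symm
          _ ≤ ‖(Lp - L0) (0, 1)‖ := norm_snd_le _
          _ ≤ ‖Lp - L0‖ * ‖((0, 1) : E × ℝ)‖ := (Lp - L0).le_opNorm _
          _ ≤ M * w * 1 := by rw [norm_zero_prodMk_one]; gcongr
          _ = M * w := mul_one _
      have h1 := (abs_le.1 hb).2
      have h2 := (abs_le.1 hCax).2
      linarith
    · rw [hfd]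
      have h : (Lp (0, 1)).1 = cf x + ((Lp - L0) (0, 1)).1 := by
        have e : (Lp - L0) (0, 1) = Lp (0, 1) - L0 (0, 1) := rfl
        rw [e, Prod.fst_sub, hL0n]
        show (Lp (0, 1)).1 = (creaseNormal G x).1 + ((Lp (0, 1)).1 - (creaseNormal G x).1)
        abel
      rw [h]
      have hb : ‖((Lp - L0) (0, 1)).1‖ ≤ M * w := by
        calc ‖((Lp - L0) (0, 1)).1‖ ≤ ‖(Lp - L0) (0, 1)‖ := norm_fst_le _
          _ ≤ ‖Lp - L0‖ * ‖((0, 1) : E × ℝ)‖ := (Lp - L0).le_opNorm _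
          _ ≤ M * w * 1 := by rw [norm_zero_prodMk_one]; gcongr
          _ = M * w := mul_one _
      calc ‖cf x + ((Lp - L0) (0, 1)).1‖ ≤ ‖cf x‖ + ‖((Lp - L0) (0, 1)).1‖ := norm_add_le _ _
        _ ≤ CS + M * w := add_le_add hCcx hb
        _ ≤ 2 * CS + 1 := by linarith
  · ---------------------------------------------------------------- the ramp zone
    have hs2w : 2 * w ≤ s := le_of_not_gt hcase
    have hsw : w < s := by linarith
    have hfd : fderiv ℝ (creaseMap G L w) (x, s) = fderiv ℝ (creaseShear G L w) (x, s) :=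
      fderiv_creaseMap_of_gt hw hsw
    have hval : creaseMap G L w (x, s) = creaseShear G L w (x, s) := creaseMap_of_le hw hsw.le
    -- the ramp at `s`: `l = λ s ∈ [0, 1]`, `l' = λ' s` with `|s l'| ≤ θ₀`
    have hl0 : 0 ≤ creaseRamp L w s := creaseRamp_nonneg L w s
    have hl1 : creaseRamp L w s ≤ 1 := creaseRamp_le_one L w s
    have hθ : |s * deriv (creaseRamp L w) s| ≤ θ₀ :=
      abs_mul_deriv_creaseRamp_le_of_le hL hw hθ₀0 hLθ s
    have hm0 : 0 ≤ s * (1 - creaseRamp L w s) := mul_nonneg hs0 (by linarith only [hl1])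
    have hmW : s * (1 - creaseRamp L w s) ≤ W := by
      have : s * (1 - creaseRamp L w s) ≤ s * 1 :=
        mul_le_mul_of_nonneg_left (by linarith only [hl0]) hs0
      linarith only [this, hsW]
    have hWCc : W * CS ≤ ε := by linarith only [hWC, mul_add W CS D, mul_nonneg hW0 hD]
    have hWD : W * D ≤ ε := by linarith only [hWC, mul_add W CS D, mul_nonneg hW0 hCc]
    have hWSc : W * Sc ≤ ε := by linarith only [hWS, mul_add W Sc Sa, mul_nonneg hW0 hSa]
    have hWSa : W * Sa ≤ ε := by linarith only [hWS, mul_add W Sc Sa, mul_nonneg hW0 hSc]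
    -- the nonlinear term `s l' (1 - a x)` is at most `am / 2` in absolute value
    have hprod : |s * deriv (creaseRamp L w) s * (1 - af x)| ≤ am / 2 := by
      rw [abs_mul]
      calc |s * deriv (creaseRamp L w) s| * |1 - af x| ≤ θ₀ * D := by gcongr
        _ ≤ am / 2 := hθ₀D
    refine ⟨?_, ?_, ?_, ?_, ?_⟩
    · -- `C⁰`
      rw [hval, creaseShear_sub_self x s, Prod.norm_mk]
      refine max_le ?_ ?_
      · calc ‖(s * (1 - creaseRamp L w s)) • (creaseNormal G x).1‖
            = s * (1 - creaseRamp L w s) * ‖cf x‖ := by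
              rw [norm_smul, Real.norm_of_nonneg hm0]
          _ ≤ W * CS := by gcongr
          _ ≤ ε := hWCc
      · rw [Real.norm_eq_abs, abs_mul, abs_of_nonneg hm0]
        have : |(creaseNormal G x).2 - 1| ≤ D := by
          rw [abs_sub_comm]; exact hDx
        calc s * (1 - creaseRamp L w s) * |(creaseNormal G x).2 - 1| ≤ W * D := by gcongr
          _ ≤ ε := hWD
    · -- face directions
      intro v
      rw [hfd, fderiv_creaseShear_apply_inl hG hL hw x v s]
      have h : ((v + (s * (1 - creaseRamp L w s)) • fderiv ℝ cf x v,
            s * (1 - creaseRamp L w s) * fderiv ℝ af x v) : E × ℝ) - (v, 0) =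
          ((s * (1 - creaseRamp L w s)) • fderiv ℝ cf x v,
            s * (1 - creaseRamp L w s) * fderiv ℝ af x v) := by
        ext <;> simp
      rw [h, Prod.norm_mk]
      have h1 : ‖(s * (1 - creaseRamp L w s)) • fderiv ℝ cf x v‖ ≤ W * Sc * ‖v‖ := by
        rw [norm_smul, Real.norm_of_nonneg hm0]
        calc s * (1 - creaseRamp L w s) * ‖fderiv ℝ cf x v‖
            ≤ W * (‖fderiv ℝ cf x‖ * ‖v‖) := by
              gcongr; exact (fderiv ℝ cf x).le_opNorm v
          _ ≤ W * (Sc * ‖v‖) := by gcongr; exact hScb x hxK₁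
          _ = W * Sc * ‖v‖ := by ring
      have h2 : ‖s * (1 - creaseRamp L w s) * fderiv ℝ af x v‖ ≤ W * Sa * ‖v‖ := by
        rw [norm_mul, Real.norm_of_nonneg hm0]
        calc s * (1 - creaseRamp L w s) * ‖fderiv ℝ af x v‖
            ≤ W * (‖fderiv ℝ af x‖ * ‖v‖) := by
              gcongr; exact (fderiv ℝ af x).le_opNorm v
          _ ≤ W * (Sa * ‖v‖) := by gcongr; exact hSab x hxK₁
          _ = W * Sa * ‖v‖ := by ring
      exact max_le (h1.trans (mul_le_mul_of_nonneg_right hWSc (norm_nonneg v)))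
        (h2.trans (mul_le_mul_of_nonneg_right hWSa (norm_nonneg v)))
    · -- normal component, lower bound
      rw [hfd, fderiv_creaseShear_apply_inr hG hL hw x s]
      have h1 := (abs_le.1 hprod).1
      have h2 : am ≤ (1 - creaseRamp L w s) * af x + creaseRamp L w s := by
        have e1 : (1 - creaseRamp L w s) * am ≤ (1 - creaseRamp L w s) * af x :=
          mul_le_mul_of_nonneg_left hax (sub_nonneg.2 hl1)
        have e2 : creaseRamp L w s * am ≤ creaseRamp L w s * 1 :=
          mul_le_mul_of_nonneg_left ham1 hl0
        have e3 : (1 - creaseRamp L w s) * am + creaseRamp L w s * am = am := by ring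
        linarith only [e1, e2, e3]
      rw [← ham]
      change am / 2 ≤ (1 - creaseRamp L w s) * af x + creaseRamp L w s +
        s * deriv (creaseRamp L w) s * (1 - af x)
      linarith only [h1, h2]
    · -- normal component, upper bound
      rw [hfd, fderiv_creaseShear_apply_inr hG hL hw x s]
      have h1 := (abs_le.1 hprod).2
      have h3 := (abs_le.1 hCax).2
      have h2 : (1 - creaseRamp L w s) * af x ≤ AS := by
        have e1 : (1 - creaseRamp L w s) * af x ≤ 1 * af x :=
          mul_le_mul_of_nonneg_right (by linarith only [hl0]) (by linarith only [ham0, hax])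
        linarith only [e1, h3]
      change (1 - creaseRamp L w s) * af x + creaseRamp L w s +
        s * deriv (creaseRamp L w) s * (1 - af x) ≤ AS + 2
      linarith only [h1, h2, hl1, ham1]
    · -- normal column, face component
      rw [hfd, fderiv_creaseShear_apply_inr hG hL hw x s]
      change ‖((1 - creaseRamp L w s) - s * deriv (creaseRamp L w) s) • cf x‖ ≤ 2 * CS + 1
      rw [norm_smul, Real.norm_eq_abs]
      have h1 : |(1 - creaseRamp L w s) - s * deriv (creaseRamp L w) s| ≤ 2 := by
        have := abs_le.1 hθ
        rw [abs_le]; constructor <;> linarith only [this, hl0, hl1, hθ₀1]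
      calc |(1 - creaseRamp L w s) - s * deriv (creaseRamp L w) s| * ‖cf x‖ ≤ 2 * CS := by
            gcongr
        _ ≤ 2 * CS + 1 := by linarith only


/-- **The estimates for the smoothed crease** (main technical statement).  Let `G` be `C^∞` with
`G (x, 0) = (x, 0)` and `(DG (x,0) (0,1)).2 > 0` for `x` in the open set `V ⊇ K`, `K` compact.
There are a neighbourhood `V'` of `K` and constants `a₀ > 0`, `A₀`, `C₀` such that for every
`ε > 0` there are parameters `L, w > 0` with layer width `W = 2 w e^L ≤ ε` for which the smoothed
crease `g = creaseMap G L w` satisfies, at every `p = (x, s)` with `x ∈ V'`, `0 ≤ s ≤ W`: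
`‖g p - p‖ ≤ ε`; `‖Dg p (v, 0) - (v, 0)‖ ≤ ε ‖v‖` for all `v`; `a₀ ≤ (Dg p (0,1)).2 ≤ A₀`;
`‖(Dg p (0,1)).1‖ ≤ C₀`.  (Recall `g = G` on `{s ≤ 0}` and `g = id` on `{s ≥ W}`,
`creaseMap_of_nonpos`, `creaseMap_eq_self`.)  Campbell–D'Onofrio–Vítek (2026), Lemma 3.1
(`J_{g_w} > 0` and the bound (3.2) `‖Dg_w‖ ≤ C (1 + σ) ‖Df‖`), in the variable-data form.
[cite: CampbellDonofrioVitek2026, Lemma 3.1] -/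
theorem exists_creaseMap_estimates (hG : ContDiff ℝ ∞ G) (hK : IsCompact K) (hV : IsOpen V)
    (hKV : K ⊆ V) (hface : ∀ x ∈ V, G (x, 0) = (x, 0))
    (hpos : ∀ x ∈ V, 0 < (creaseNormal G x).2) :
    ∃ (V' : Set E) (a₀ A₀ C₀ : ℝ), IsOpen V' ∧ K ⊆ V' ∧ 0 < a₀ ∧
      ∀ ε : ℝ, 0 < ε → ∃ L w : ℝ, 0 < L ∧ 0 < w ∧ 2 * w * exp L ≤ ε ∧
        ∀ p : E × ℝ, p.1 ∈ V' → p.2 ∈ Icc 0 (2 * w * exp L) →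
          ‖creaseMap G L w p - p‖ ≤ ε ∧
          (∀ v : E, ‖fderiv ℝ (creaseMap G L w) p (v, 0) - (v, 0)‖ ≤ ε * ‖v‖) ∧
          a₀ ≤ (fderiv ℝ (creaseMap G L w) p (0, 1)).2 ∧
          (fderiv ℝ (creaseMap G L w) p (0, 1)).2 ≤ A₀ ∧
          ‖(fderiv ℝ (creaseMap G L w) p (0, 1)).1‖ ≤ C₀ := by
  -- a neighbourhood `V₁` of `K` with compact closure `K₁ ⊆ V`, and bounds on `K₁`
  obtain ⟨V₁, hV₁o, hKV₁, hclV, hK₁⟩ := exists_open_between_and_isCompact_closure hK hV hKV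
  have hV₁V : V₁ ⊆ V := subset_closure.trans hclV
  have hcf_smooth : ContDiff ℝ ∞ (fun y => (creaseNormal G y).1) := (contDiff_creaseNormal hG).fst
  have haf_smooth : ContDiff ℝ ∞ (fun y => (creaseNormal G y).2) := (contDiff_creaseNormal hG).snd
  obtain ⟨Cc, hCc, hCcb⟩ := exists_nonneg_bound hK₁ hcf_smooth.continuous.continuousOn
  obtain ⟨Ca, hCa, hCab⟩ := exists_nonneg_bound hK₁ haf_smooth.continuous.continuousOn
  obtain ⟨amin, hamin, haminb⟩ := exists_pos_le_of_isCompact hK₁ haf_smooth.continuous.continuousOn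
    fun y hy => hpos y (hclV hy)
  obtain ⟨V', hV'o, hKV', hrec⟩ := exists_creaseMap_estimates_of_bounds hG hK hV₁o hKV₁
    (fun x hx => hface x (hV₁V hx)) hamin hCa hCc
    (fun x hx => haminb x (subset_closure hx)) (fun x hx => hCab x (subset_closure hx))
    (fun x hx => hCcb x (subset_closure hx))
  exact ⟨V', min amin 1 / 2, Ca + 2, 2 * Cc + 1, hV'o, hKV', by positivity, hrec⟩

/-- **Smoothing a crease along a hyperplane** (packaged form).  Let `G : E × ℝ → E × ℝ` be `C^∞`,
with `G (x, 0) = (x, 0)` and `(DG (x,0) (0,1)).2 > 0` for all `x` in an open set `V ⊇ K`, `K`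
compact — so that the map equal to `G` on `{s ≤ 0}` and to the identity on `{s ≥ 0}` is a
crease along the face `K × {0}`.  There are constants `a₀ > 0`, `A₀`, `C₀` (depending on `G` near
`K` only) such that for every `ε > 0` there are a width `W ∈ (0, ε]`, a neighbourhood `V'` of `K`
and a `C^∞` map `g` with: `g = G` on `{s ≤ 0}`; `g = id` on `{s ≥ W}`; and for `x ∈ V'`,
`0 ≤ s ≤ W`: `‖g (x,s) - (x,s)‖ ≤ ε`, `‖Dg (x,s) (v,0) - (v,0)‖ ≤ ε‖v‖`,
`a₀ ≤ (Dg (x,s) (0,1)).2 ≤ A₀`, `‖(Dg (x,s) (0,1)).1‖ ≤ C₀`.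
Munkres (1960), §3 (smoothing across an `(n-1)`-simplex, `Γ₁ = 0`); Campbell–D'Onofrio–Vítek
(2026), Lemma 3.1. [cite: CampbellDonofrioVitek2026, Lemma 3.1] -/
theorem exists_crease_smoothing (hG : ContDiff ℝ ∞ G) (hK : IsCompact K) (hV : IsOpen V)
    (hKV : K ⊆ V) (hface : ∀ x ∈ V, G (x, 0) = (x, 0))
    (hpos : ∀ x ∈ V, 0 < (fderiv ℝ G (x, 0) (0, 1)).2) :
    ∃ a₀ A₀ C₀ : ℝ, 0 < a₀ ∧ ∀ ε : ℝ, 0 < ε →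
      ∃ (W : ℝ) (V' : Set E) (g : E × ℝ → E × ℝ), 0 < W ∧ W ≤ ε ∧ IsOpen V' ∧ K ⊆ V' ∧
        ContDiff ℝ ∞ g ∧ (∀ p : E × ℝ, p.2 ≤ 0 → g p = G p) ∧ (∀ p : E × ℝ, W ≤ p.2 → g p = p) ∧
        ∀ p : E × ℝ, p.1 ∈ V' → p.2 ∈ Icc 0 W →
          ‖g p - p‖ ≤ ε ∧ (∀ v : E, ‖fderiv ℝ g p (v, 0) - (v, 0)‖ ≤ ε * ‖v‖) ∧
          a₀ ≤ (fderiv ℝ g p (0, 1)).2 ∧ (fderiv ℝ g p (0, 1)).2 ≤ A₀ ∧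
          ‖(fderiv ℝ g p (0, 1)).1‖ ≤ C₀ := by
  obtain ⟨V', a₀, A₀, C₀, hV'o, hKV', ha₀, h⟩ :=
    exists_creaseMap_estimates hG hK hV hKV hface hpos
  refine ⟨a₀, A₀, C₀, ha₀, fun ε hε => ?_⟩
  obtain ⟨L, w, hL, hw, hWε, hest⟩ := h ε hε
  refine ⟨2 * w * exp L, V', creaseMap G L w, by positivity, hWε, hV'o, hKV',
    contDiff_creaseMap hG hL hw, fun p hp => creaseMap_of_nonpos hw hp,
    fun p hp => creaseMap_eq_self hL hw hp, fun p hp1 hp2 => hest p hp1 hp2⟩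

end Main

end Literature.Topology.FourManifolds
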